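import Mathlib

/-!
# Corner inequality `A/j+jp+jjp+mj` — certificate chunks, part 3
(blind cell PercRepro2, night-2 g28; proofs/NIGHT2-DARC.md §70.7)
-/

namespace Summit.Ventures.PercRepro2.Coin

section JpCornerPart

variable {R : Type*} [Field R] [LinearOrder R] [IsStrictOrderedRing R]

omit [LinearOrder R] [IsStrictOrderedRing R] in
set_option maxHeartbeats 3200000 in
set_option maxRecDepth 100000 in
/-- Chunk 10 of the certificate identity. -/
lemma jp_corner_j_jp_jjp_mj_chunk10_eq (cO _cM cJ cMJ cJP _cMJP cJJP _cMJJP uO uM _uJ uMJ uJP uMJP uJJP uMJJP : R) :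
    (-2 : R) * uMJ * uJP * uMJJP ^ 3 + (-2 : R) * uM * uMJ ^ 2 * uJP * uMJJP + (-2 : R) * uM ^ 2 * uJP * uMJJP ^ 2 + (-2 : R) * uO * uM * uJJP * uMJJP ^ 2 + (-2 : R) * cJJP * uM ^ 2 * uJP * uMJJP + (2 : R) * cJJP * uO * uM * uMJJP ^ 2 + (2 : R) * cJP * uM ^ 2 * uMJJP ^ 2 + (2 : R) * cJP * cJJP * uM ^ 2 * uMJJP + (2 : R) * cMJ * uJP * uMJJP ^ 3 + (2 : R) * cMJ * uM * uMJ * uJP * uMJJP + (-2 : R) * cJ * uMJ * uJP * uMJJP ^ 2 + (-2 : R) * cJ * uMJ ^ 2 * uJP * uMJJP + (2 : R) * cJ * cJP * uMJ * uMJJP ^ 2 + (2 : R) * cJ * cJP * uMJ ^ 2 * uMJJP + (-6 : R) * cO * cJJP * uM * uJJP * uMJJP + (6 : R) * cO * cJJP ^ 2 * uM * uMJJP + (-2 : R) * cO * cJP * uJP * uMJJP ^ 2 + (-2 : R) * cO * cJP * cJJP * uJJP * uMJJP + (2 : R) * cO * cJP * cJJP ^ 2 * uMJJP + (2 : R) *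 cO * cJP ^ 2 * uMJJP ^ 2 + (-2 : R) * cO * cJ * uJP * uMJP * uMJJP + (2 : R) * cO * cJ * cJP * uMJP * uMJJP = (2 : R) * ((cMJ - uMJ) * uM * (uMJ * uJP * uMJJP)) + (2 : R) * ((cMJ - uMJ) * uJP * (uMJJP ^ 3)) + (2 : R) * ((cJP - uJP) * cO * (cJP * uMJJP ^ 2)) + (2 : R) * ((cJP - uJP) * cO * (cJ * uMJP * uMJJP)) + (2 : R) * ((cJP - uJP) * cJ * (uMJ * uMJJP ^ 2)) + (2 : R) * ((cJP - uJP) * cJ * (uMJ ^ 2 * uMJJP)) + (2 : R) * ((cJP - uJP) * cJJP * (uM ^ 2 * uMJJP)) + (2 : R) * ((cJP - uJP) * uM * (uM * uMJJP ^ 2)) + (6 : R) * ((cJJP - uJJP) * cO * (cJJP * uM * uMJJP)) + (2 : R) * ((cJJP - uJJP) * cO * (cJP * cJJP * uMJJP)) + (2 : R) * ((cJJP - uJJP) * uO * (uM * uMJJP ^ 2)) := by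
  ring

set_option maxHeartbeats 3200000 in
set_option maxRecDepth 100000 in
/-- Chunk 10 of the certificate is nonnegative. -/
lemma jp_corner_j_jp_jjp_mj_chunk10_nonneg (cO cM cJ cMJ cJP cMJP cJJP cMJJP uO uM uJ uMJ uJP uMJP uJJP uMJJP : R)
    (_hcO : 0 ≤ cO) (_hcM : 0 ≤ cM) (_hcJ : 0 ≤ cJ) (_hcMJ : 0 ≤ cMJ) (_hcJP : 0 ≤ cJP) (_hcMJP : 0 ≤ cMJP) (_hcJJP : 0 ≤ cJJP) (_hcMJJP : 0 ≤ cMJJP) (_huO : 0 ≤ uO) (_huM : 0 ≤ uM) (_huJ : 0 ≤ uJ) (_huMJ : 0 ≤ uMJ) (_huJP : 0 ≤ uJP) (_huMJP : 0 ≤ uMJP) (_huJJP : 0 ≤ uJJP) (_huMJJP : 0 ≤ uMJJP)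
    (_hord_o : uO ≤ cO) (_hord_m : uM ≤ cM) (_hord_j : uJ ≤ cJ) (hord_mj : uMJ ≤ cMJ) (hord_jp : uJP ≤ cJP) (_hord_mjp : uMJP ≤ cMJP) (hord_jjp : uJJP ≤ cJJP) (_hord_mjjp : uMJJP ≤ cMJJP)
     :
    0 ≤ (-2 : R) * uMJ * uJP * uMJJP ^ 3 + (-2 : R) * uM * uMJ ^ 2 * uJP * uMJJP + (-2 : R) * uM ^ 2 * uJP * uMJJP ^ 2 + (-2 : R) * uO * uM * uJJP * uMJJP ^ 2 + (-2 : R) * cJJP * uM ^ 2 * uJP * uMJJP + (2 : R) * cJJP * uO * uM * uMJJP ^ 2 + (2 : R) * cJP * uM ^ 2 * uMJJP ^ 2 + (2 : R) * cJP * cJJP * uM ^ 2 * uMJJP + (2 : R) * cMJ * uJP * uMJJP ^ 3 + (2 : R) * cMJ * uM * uMJ * uJP * uMJJP + (-2 : R) * cJ * uMJ * uJP * uMJJP ^ 2 + (-2 : R) * cJ * uMJ ^ 2 * uJP * uMJJP + (2 : R) * cJ * cJP * uMJ * uMJJP ^ 2 + (2 : R) * cJ * cJP * uMJ ^ 2 *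 uMJJP + (-6 : R) * cO * cJJP * uM * uJJP * uMJJP + (6 : R) * cO * cJJP ^ 2 * uM * uMJJP + (-2 : R) * cO * cJP * uJP * uMJJP ^ 2 + (-2 : R) * cO * cJP * cJJP * uJJP * uMJJP + (2 : R) * cO * cJP * cJJP ^ 2 * uMJJP + (2 : R) * cO * cJP ^ 2 * uMJJP ^ 2 + (-2 : R) * cO * cJ * uJP * uMJP * uMJJP + (2 : R) * cO * cJ * cJP * uMJP * uMJJP := by
  rw [jp_corner_j_jp_jjp_mj_chunk10_eq cO cM cJ cMJ cJP cMJP cJJP cMJJP uO uM uJ uMJ uJP uMJP uJJP uMJJP]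
  have H200 := mul_nonneg (mul_nonneg (sub_nonneg.2 hord_mj) (by positivity : (0:R) ≤ uM)) (by positivity : (0:R) ≤ uMJ * uJP * uMJJP)
  have H201 := mul_nonneg (mul_nonneg (sub_nonneg.2 hord_mj) (by positivity : (0:R) ≤ uJP)) (by positivity : (0:R) ≤ uMJJP ^ 3)
  have H202 := mul_nonneg (mul_nonneg (sub_nonneg.2 hord_jp) (by positivity : (0:R) ≤ cO)) (by positivity : (0:R) ≤ cJP * uMJJP ^ 2)
  have H203 := mul_nonneg (mul_nonneg (sub_nonneg.2 hord_jp) (by positivity : (0:R) ≤ cO)) (by positivity : (0:R) ≤ cJ * uMJP * uMJJP)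
  have H204 := mul_nonneg (mul_nonneg (sub_nonneg.2 hord_jp) (by positivity : (0:R) ≤ cJ)) (by positivity : (0:R) ≤ uMJ * uMJJP ^ 2)
  have H205 := mul_nonneg (mul_nonneg (sub_nonneg.2 hord_jp) (by positivity : (0:R) ≤ cJ)) (by positivity : (0:R) ≤ uMJ ^ 2 * uMJJP)
  have H206 := mul_nonneg (mul_nonneg (sub_nonneg.2 hord_jp) (by positivity : (0:R) ≤ cJJP)) (by positivity : (0:R) ≤ uM ^ 2 * uMJJP)
  have H207 := mul_nonneg (mul_nonneg (sub_nonneg.2 hord_jp) (by positivity : (0:R) ≤ uM)) (by positivity : (0:R) ≤ uM * uMJJP ^ 2)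
  have H208 := mul_nonneg (mul_nonneg (sub_nonneg.2 hord_jjp) (by positivity : (0:R) ≤ cO)) (by positivity : (0:R) ≤ cJJP * uM * uMJJP)
  have H209 := mul_nonneg (mul_nonneg (sub_nonneg.2 hord_jjp) (by positivity : (0:R) ≤ cO)) (by positivity : (0:R) ≤ cJP * cJJP * uMJJP)
  have H210 := mul_nonneg (mul_nonneg (sub_nonneg.2 hord_jjp) (by positivity : (0:R) ≤ uO)) (by positivity : (0:R) ≤ uM * uMJJP ^ 2)
  exact add_nonneg (add_nonneg (add_nonneg (add_nonneg (add_nonneg (add_nonneg (add_nonneg (add_nonneg (add_nonneg (add_nonneg (mul_nonneg (by norm_num : (0:R) ≤ (2 : R)) H200) (mul_nonneg (by norm_num : (0:R) ≤ (2 : R)) H201)) (mul_nonneg (by norm_num : (0:R) ≤ (2 : R)) H202)) (mul_nonneg (by norm_num : (0:R) ≤ (2 : R)) H203)) (mul_nonneg (by norm_num : (0:R) ≤ (2 : R)) H204)) (mul_nonneg (by norm_num : (0:R) ≤ (2 : R)) H205)) (mul_nonneg (by norm_num : (0:R) ≤ (2 : R)) H206)) (mul_nonneg (by norm_num : (0:R)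 ≤ (2 : R)) H207)) (mul_nonneg (by norm_num : (0:R) ≤ (6 : R)) H208)) (mul_nonneg (by norm_num : (0:R) ≤ (2 : R)) H209)) (mul_nonneg (by norm_num : (0:R) ≤ (2 : R)) H210)

end JpCornerPart

end Summit.Ventures.PercRepro2.Coin
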